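import Literature.MathematicalPhysics.QuantumFieldTheory.Balaban1983to89.B6Block112GEV1

/-!
# `Balaban1983to89.B6Block113GEV1` — T. Bałaban, *Propagators and renormalization transformations for lattice gauge theories. II*,
# Commun. Math. Phys. **96** (1984) 223–250 [Balaban1984PropagatorsII], Prop. 2.5 p. 246 with [4] = *… I*, CMP **95** (1984) Prop. 1.2
# (1.113) p. 36: towards the member `‖ζ∇G∇*J‖_α ≤ O(1)e^{−δ₂|y−y′|}(‖ζ‖_α + |ζ|)(‖J‖_{α+ε} + |J|)` for the two-scale `G` of (2.90) — the term
# `∇_μG^{(w′)}∇_λ*`: [4] (1.113) FOR `G_k` BY NAME (all scales) transported to a PAIR BOUND, HÖLDER IN THE OUTPUT AND IN THE INPUT, on the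
# two-scale carriers, sources supported over the unit sites within `r` of `y′` — file M4 of the (1.112)/(1.113) members (p38 gen 22); the (1.113)
# twin of this seat's `B6BlockHolderGDivGEV1` (the (1.111) member) and `B6Block112GEV1` (the (1.112) member)

statement-level skeleton of published theorems with citation tags; proofs where landed; nothing here is a claim about the Yang–Mills mass gap

PDF held: `paper:balaban1984-cmp96-propagators-rt-ii` (journal page = PDF page + 222), p. 246 [PDF 24]; `paper:balaban1984-cmp95-propagators-rt-i` ([4],
journal page = PDF page + 16), pp. 35–36 [PDF 19–20].  PRINT.  [4] p. 36 (verbatim, as quoted in the tree's `B5.Prop12Printed`): *"‖ζ∇G∇*J‖_α ≤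
O(1)e^{−δ₀|y−y′|}(‖ζ‖_α + |ζ|)(‖J‖_{α+ε} + |J|) (1.113) for 0 ≤ α < 1, ε > 0, α + ε < 1, ζ ∈ C₀^∞(Δ̃(y)), supp J ⊂ Δ̃(y′), with the constant
O(1) depending on d, α and ε (O(1) → ∞ if α → 1 or ε → 0)"*; (1.109) p. 35: *"‖A‖_α = max_μ sup_{x,x′:|x−x′|≤1} |x−x′|^{−α}|A_μ(x) − A_μ(x′)|"*;
[B6] p. 246: *"From these representations we obtain all the necessary properties of the operators H_j, G̃_j. They follow from the Proposition 1.2 …"*.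

CITATION HEADER (lean-in-tree rule) — WHAT IS REPRODUCED.  Phase-2 file of the `lit-balaban` typed skeleton (HOME `run/shared/lean/pub/lit-balaban/`),
seat **p38 gen 22** (B6 fold owner r03, referee ref-4; p22 g15 hand-off 2026-08-22T10:32Z of the (1.111)–(1.113) members), FILE M4 of the (1.112)/(1.113)
members of p22's Prop. 2.5 two-level decay programme for the genuine two-scale `G` of (2.90) (`…B6SectCTwoScaleV1Lattice.tsV1`, `Λ′` arbitrary,
`c = L^j`); SKELETON rows **B6.Prop2.5** / **B6.Eq2.131** and [4] **B5.Prop1.2** (cells only; decls of record untouched).  In the differentiated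
representation (2.129) (file M3 `…B6Prop25Eq112TwoScaleV1.DGDadj_apply_eq`), `∇_μG∇_λ* = (∇_μ∂H′_j)C(∇_λ∂H′_j)* + ∇_μG^{(w′)}∇_λ* −
(∇_μH_j)(Q_jG^{(w′)}∇_λ*) + (∇_μH_j)C̃(∇_λH_j)* − (∇_μM)K₂∇_λ* − (∇_μK₂*)M∇_λ* + (∇_μK₂*)MK₂∇_λ*`, every term but `∇_μG^{(w′)}∇_λ*` has a PAIR
(Hölder-in-the-output) block bound from landed factor bounds (gen 21 files H2–H4); the term `∇_μG^{(w′)}∇_λ*` needs the Hölder norm `‖J‖_{α+ε}` of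
the source, and its pair bound is [4] (1.113) FOR `G_k` BY NAME.  THIS FILE.  §1 **`h2L_allScales`**: [4] PROPOSITION 1.2, THE MEMBER (1.113), FOR
`G_k = Δ_a⁻¹` ON B5's CARRIERS (r02's `h2L`: `h2L a (.ten T) α ζ = ‖ζ∇G_k∇*T‖_α`, `cutHL α ζ = ‖ζ‖_α + |ζ|`, `holderL` = the (1.109) seminorm), ALL
TORI, ALL SCALES `1 ≤ k ≤ m + K`, HYPOTHESIS-FREE — the `h2` clause of the tree's Prop. 1.2 on B5's torus family of record
(`…B5Prop12GHolds.prop12_famG_printed`, re-indexed by p19's `famG_reindex`).  §2 **`abs_DGEDadj_sub_le_close`**: CLOSE PAIRS — if (1.113) holds on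
B5's carrier of scale `j` at `(O(1)(α,ε), δ)`, then for `x` supported over the unit sites within `r` of `y′`, `|x| ≤ X`, `(α+ε)`-Hölder quotients
`≤ X_θ` (file M1a §3 `holderL_srcT_le`), and fine bonds `b₁ = ⟨x, ν⟩`, `b₂ = ⟨x′, ν⟩` with `0 < |x − x′| ≤ ¼` (unit of `T₁^{(j)}`):
`|(∇_μG^{(w′)}∇_λ*x)(b₁) − (∇_μG^{(w′)}∇_λ*x)(b₂)| ≤ O(1)(α,ε)·K(1)e^{(1+δ)(r+3)}·(L_θ+1)(c_P+1)e^{3δ}·e^{−δ|y(x) − y′|_T}·(X_θ + X)·|x − x′|^α` —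
the values are `Re` of the field `∇(Δ_a⁻¹∇*T)` of the tensor source (file M1a §2 `DGEDadj_apply_eq`), `T = Σ_z ζ′_zT` (r02's unit-scale partition,
file M1b §4), r02's plateau cut-off `χ = cutP(nearOf(EK x))` is `1` at both points (`cutP_nearOf_eq_one(_of_distU_le)`), is supported in the cube of
`ỹ = nearOf(EK x)` with `‖χ‖_α + |χ| ≤ L_θ + 1` (`cutH_le`), so for each piece the pair is a pair of the cut field `χ∇(Δ_a⁻¹∇*ζ′_zT)` whose Hölder
seminorm is (1.113) at `(ỹ, z)`; `|ỹ − y(x)| ≤ 3`; far pieces vanish (file M1b `srcPiece_eq_zero_of_far`), the near ones are counted by file M1b's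
`sum_ball_exp_le`.  §3 **`pair113_DGEDadj_scaling`**: ONE `δ₀ > 0` (on `d, L, a`) and, for every rate `0 < δ ≤ δ₀` and every `0 ≤ α`, `0 < ε`,
`α + ε < 1`, ONE `C ≥ 0`, for all volumes, all scales `j ≤ m + K`, all `λ, μ`: for `x` as above and same-direction fine bonds at `|x − x′|_∞ ≤ L^j`,
`|(∇_μG^{(w′)}∇_λ*x)(b₁) − (…)(b₂)| ≤ C·e^{(1+δ)(r+3)}·e^{−δ|y(x) − y′|_T}·(X_θ + X)·(|x − x′|_∞/L^j)^α` — close pairs by §2 (they force `j ≥ 1`),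
far pairs (`¼ < t ≤ 1`, `t^{−α} ≤ 4`) by file M1b's cube-sup bound (1.112) at both bonds with the input exponent `α + ε`.  IMPORTS BY NAME,
restating nothing.  THEOREMS ONLY (no `def`, no `def … : Prop`); standard axioms.  HONEST SCOPE / DIVERGENCES. (1) as files M1a/M1b: one `λ`, one
`μ`, differences with the factor `L^j`; the printed `‖·‖_α` (max over `μ`, sup over pairs) is recovered pair by pair. (2) The constants and the growth
`e^{(1+δ)(r+3)}` are ours (print: `O(1)` depending on `d, α, ε`). (3) Scale `j = 0` needs no (1.113): a close pair forces `L^j ≥ 4`. (4) No new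
definition, no new hypothesis.  NOT summit progress.  Unit `lit-balaban-p38` (gen 22), 2026-08-22.
-/

noncomputable section

open scoped InnerProductSpace BigOperators Matrix
open Finset

namespace Literature.MathematicalPhysics.QuantumFieldTheory.Balaban1983to89.B6Block113GEV1

open LatticeFieldCalculus B5SectBStatements B5Eq117TorusCarriers B6SectADomainsV1 B6SectAOperatorsV1 B6SectAVectorModelV1 B6SectCOperators
  B6SectCTwoScaleV1 B6SectCTwoScaleV1Lattice B5Eq118OneStroke
open BalabanImbrieJaffe1984to88.BIJ85AxialPropagator411 (BondSpace)
open B4Sect5Torus (IsPseudoDist SumBound)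
open B4TorusKernel.MultiPeriod (torusSupNorm torusSupNorm_nonneg)
open B4Sect5Proof (latticeConst latticeConst_nonneg)
open B3TorusRadialSums (supDist_eq_zero_iff)
open B5Prop11Plancherel (Tor fine unitVec)
open B5Prop11Lattice (divT)
open B5Prop11SettingModel (Loc189)
open B5DeltaA169 (DeltaA)
open B5Prop12FieldsLattice (distSite distU cubeT cubeB suppInL supNormL holderL holderT h2L cutInL cutHL smulT)
open B5SettingP12Real (LocR)
open B5Prop12GLattice (famG)
open B5CoverP12Lattice (wP wP_eq_zero_of_not_mem Lw Lw_nonneg cutP nearOf Lθ Lθ_nonneg cutInL_cutP cutP_nearOf_eq_one_of_distU_le cutP_nearOf_eq_one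
  mem_cubeT_nearOf)
open B5GlobCoverP12Lattice (pieceL piece_supp piece_sup piece_holder sum_pieces_ten grad_sum divT_sum cutH_le)
open B5RowSumsP12Lattice (distSite_triangle)
open B6LowerBound2153Torus (rep)
open B6BlockDecayCalculus (torusDist_isPseudoDist)
open B6BlockDecayHprimeCovV1 (supDist_cast_eq_torusSupNorm)
open B6BlockHolderCalculus (self_le_rpow_of_le_one')
open B6Block112DictionaryV1 (DGEDadj_apply_eq holderL_srcT_le)
open B6BlockHolderGDivGEV1 (suppInL_srcT supNormL_srcT_le)
open B6Block112GEV1 (pieceL_srcT_eq srcPiece_eq_zero_of_far sum_ball_exp_le abs_DGEDadj_apply_le cubeSup112_DGEDadj_scaling)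
open BalabanImbrieJaffe1984to88.BIJ85Ineq722Torus (supDist_blk_le_one)
open BalabanImbrieJaffe1984to88.BIJ85Prop12BridgeGeometry (supDist_cast_eq_distSite EK_mem_cubeT_blk distU_EK distSite_le_three_of_mem_mem two_le_Mk)
open BalabanImbrieJaffe1984to88.BIJ85Prop12AllTori (famG_reindex)
open LatticeNorms (supNorm holder_bound holderSeminorm_nonneg)

/-! ## §1  [4] Proposition 1.2, the member `‖ζ∇G∇*J‖_α` of (1.113), on B5's carriers: all tori, all scales `k ≥ 1` -/

section AllScales

/-- **[4] PROPOSITION 1.2, THE MEMBER (1.113) FOR `G_k = Δ_a⁻¹`, ALL TORI OF DIMENSION `d` AND BLOCK SIZE `L`, ALL SCALES `1 ≤ k ≤ m + K`,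
HYPOTHESIS-FREE**: ONE `δ₀ > 0` and ONE `O(1)(α, ε)` (depending on `d, L, a` only) such that for every torus `P` (`P.d = d`, `P.L = L`), every
`1 ≤ k ≤ m + K`, every `0 ≤ α`, `0 < ε`, `α + ε < 1`, every real source `J` with `supp J ⊂ Δ̃(y′)` and cut-off `ζ` supported in `Δ̃(y)` (B5's cubes):
`‖ζ∇G_k∇*J‖_α ≤ O(1)(α,ε)e^{−δ₀|y−y′|}(‖ζ‖_α + |ζ|)(‖J‖_{α+ε} + |J|)` on B5's carriers (r02's `h2L`, genuine on tensor sources, `0` on the others;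
`cutHL` = `‖ζ‖_α + |ζ|`, `holderL` = (1.109)) — the tree's Prop. 1.2 on B5's torus family of record (`prop12_famG_printed`, member `h2`, p19's
`famG_reindex`). [cite: Balaban1984PropagatorsI, Prop. 1.2 (1.113) p.36, pp.39–40 («Thus we have finished the proof of Proposition 1.2.»)] -/
theorem h2L_allScales (d L : ℕ) {a : ℝ} (ha : 0 < a) :
    ∃ δ : ℝ, 0 < δ ∧ ∃ Cαε : ℝ → ℝ → ℝ, ∀ (P : Params) (_ : P.d = d) (_ : P.L = L) (k : ℕ) (_ : 1 ≤ k) (_ : k ≤ P.m + P.K)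
      (α ε : ℝ) (J : LocR (P.L ^ k) (Mk P k)) (ζ : Tor (fine (P.L ^ k) (Mk P k)) → ℝ) (y y' : Tor (Mk P k)),
      0 ≤ α → 0 < ε → α + ε < 1 → cutInL (P.L ^ k) (Mk P k) ζ y → suppInL (P.L ^ k) (Mk P k) J.emb y' →
      h2L (P.L ^ k) (Mk P k) a J.emb α ζ ≤
        Cαε α ε * Real.exp (-(δ * distSite (Mk P k) y y')) * cutHL (P.L ^ k) (Mk P k) α ζ *
          (holderL (P.L ^ k) (Mk P k) (α + ε) J.emb + supNormL (P.L ^ k) (Mk P k) J.emb) := by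
  by_cases h : 1 ≤ d ∧ (Odd L ∧ 1 < L)
  · obtain ⟨δ₁, C₁, Cα₁, Cε₁, Cαε₁, hδ₁, hC₁, H₁⟩ := B5Prop12GHolds.prop12_famG_printed (d := d) (L := L) h.1 h.2 ha
    refine ⟨δ₁, hδ₁, Cαε₁, ?_⟩
    intro P hPd hPL k hk1 hk α ε J ζ y y' hα0 hε0 hαε hζ hJ
    subst hPd; subst hPL
    have H := H₁ ⟨⟨P.d, P.L, P.m + P.K - k, k, P.hd, P.hL⟩, rfl, rfl, hk1⟩
    rw [famG_reindex] at H
    obtain ⟨-, -, -, Hh2, -⟩ := H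
    exact Hh2 α ε J ζ y y' hα0 hε0 hαε hζ hJ
  · -- no torus has `d = 0` or an inadmissible `L`: the range is empty
    refine ⟨1, one_pos, fun _ _ => 0, fun P hPd hPL k hk1 hk α ε J ζ y y' hα0 hε0 hαε hζ hJ => ?_⟩
    exact (h ⟨hPd ▸ P.hd, hPL ▸ P.hL⟩).elim

end AllScales

/-! ## §2  Close pairs: the product (1.113) with the plateau cut-off, piece by piece -/

section Transport

variable {d L m K : ℕ} [NeZero L] {hd : 1 ≤ d + 1} {hL : Odd L ∧ 1 < L} {j : ℕ}
  (hj' : j ≤ (⟨d + 1, L, m, K, hd, hL⟩ : Params).m + (⟨d + 1, L, m, K, hd, hL⟩ : Params).K)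
  (hc : ((L : ℝ) ^ j) ≠ 0) {a : ℝ} (ha : 0 < a) (hw' : (0 : ℝ) < a * ((L : ℝ) ^ j) ^ (d + 1))

/-- `A(Σ_i v_i) = Σ_i Av_i` (matrix action on a finite sum of vectors). [cite: Balaban1984PropagatorsI, (1.89) p.33 (linearity of G; bookkeeping ours)] -/
private theorem mulVec_finset_sum' {ι₁ ι₂ : Type*} [Fintype ι₁] [Fintype ι₂] {κ : Type*} (A : Matrix ι₂ ι₁ ℂ) (s : Finset κ)
    (v : κ → ι₁ → ℂ) : A *ᵥ (∑ i ∈ s, v i) = ∑ i ∈ s, A *ᵥ v i := by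
  have h := map_sum (Matrix.mulVecLin A) v s
  simp only [Matrix.mulVecLin_apply] at h
  exact h

/-- `∇(Δ_a⁻¹∇*0) = 0`. [cite: Balaban1984PropagatorsI, (1.89) p.33 (linearity; bookkeeping ours)] -/
private theorem grad_G_divT_zero {n : ℕ} [NeZero n] {M : Fin (d + 1) → ℕ} [∀ μ, NeZero (M μ)] (A : Matrix (Tor (fine n M) × Fin (d + 1)) (Tor (fine n M) × Fin (d + 1)) ℂ) :
    B5Prop11Lattice.grad n M (A *ᵥ divT n M (0 : Fin (d + 1) → (Tor (fine n M) × Fin (d + 1) → ℂ))) = 0 := by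
  have h0 : divT n M (0 : Fin (d + 1) → (Tor (fine n M) × Fin (d + 1) → ℂ)) = 0 := by
    unfold divT
    exact Finset.sum_eq_zero fun ν _ => by rw [Pi.zero_apply, Matrix.mulVec_zero]
  rw [h0, Matrix.mulVec_zero]
  funext ν
  unfold B5Prop11Lattice.grad
  rw [Matrix.mulVec_zero]
  rfl

include ha in
/-- **THE DIFFERENCE OF `∇_μG^{(w′)}∇_λ*x` AT A CLOSE PAIR OF FINE BONDS, HÖLDER INPUT**: if the member (1.113) holds on B5's carrier of scale `j` of this
torus at `(O(1)(α,ε), δ)` (§1), then for directions `λ, μ`, a fine bond field `x` supported over the unit sites within `r` of `y′` with `|x| ≤ X` and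
`|x(b) − x(b′)| ≤ X_θ(|b₋ − b₋′|_∞/n)^{α+ε}` on same-direction pairs at `|b₋ − b₋′|_∞ ≤ n`, and fine bonds `b₁ = ⟨x, ν⟩`, `b₂ = ⟨x′, ν⟩` with
`0 < |x − x′| ≤ ¼` (unit of `T₁^{(j)}`):
`|(∇_μG^{(w′)}∇_λ*x)(b₁) − (∇_μG^{(w′)}∇_λ*x)(b₂)| ≤ O(1)(α,ε)·K(1)e^{(1+δ)(r+3)}·(L_θ+1)(c_P+1)e^{3δ}·e^{−δ|y(x) − y′|_T}·(X_θ + X)·|x − x′|^α`,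
`c_P = max(1, Lw(d+1))` — file M1a §2 (the values), file M1b §4 (the pieces `T = Σ_z ζ′_zT`), r02's plateau cut-off `χ = cutP(nearOf(EK x))` (`= 1` at both
points, supported in the cube of `ỹ = nearOf(EK x)`, `‖χ‖_α + |χ| ≤ L_θ + 1`), (1.113) for each piece at `(ỹ, z)` with `‖ζ′_zT‖_{α+ε} ≤ c_P(‖T‖_{α+ε} + |T|)`
(r02's `piece_holder`), `|ỹ − y(x)| ≤ 3`, and the ball count `sum_ball_exp_le`. [cite: Balaban1984PropagatorsI, Prop. 1.2 (1.113) p.36, (1.109) p.35; Balaban1984PropagatorsII, p.246 («They follow from the Proposition 1.2»)] -/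
theorem abs_DGEDadj_sub_le_close {Cαε δ α ε : ℝ} (hC0 : 0 ≤ Cαε) (hδ : 0 ≤ δ) (hα0 : 0 ≤ α) (hα1 : α < 1) (hε0 : 0 < ε) (hαε : α + ε < 1)
    (H : ∀ (T : LocR (((⟨d + 1, L, m, K, hd, hL⟩ : Params).L) ^ j) (Mk (⟨d + 1, L, m, K, hd, hL⟩ : Params) j)) (ζ : Tor (fine (((⟨d + 1, L, m, K, hd, hL⟩ : Params).L) ^ j) (Mk (⟨d + 1, L, m, K, hd, hL⟩ : Params) j)) → ℝ) (y y' : Tor (Mk (⟨d + 1, L, m, K, hd, hL⟩ : Params) j)),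
      cutInL (((⟨d + 1, L, m, K, hd, hL⟩ : Params).L) ^ j) (Mk (⟨d + 1, L, m, K, hd, hL⟩ : Params) j) ζ y → suppInL (((⟨d + 1, L, m, K, hd, hL⟩ : Params).L) ^ j) (Mk (⟨d + 1, L, m, K, hd, hL⟩ : Params) j) T.emb y' →
      h2L (((⟨d + 1, L, m, K, hd, hL⟩ : Params).L) ^ j) (Mk (⟨d + 1, L, m, K, hd, hL⟩ : Params) j) a T.emb α ζ ≤
        Cαε * Real.exp (-(δ * distSite (Mk (⟨d + 1, L, m, K, hd, hL⟩ : Params) j) y y')) * cutHL (((⟨d + 1, L, m, K, hd, hL⟩ : Params).L) ^ j) (Mk (⟨d + 1, L, m, K, hd, hL⟩ : Params) j) α ζ *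
          (holderL (((⟨d + 1, L, m, K, hd, hL⟩ : Params).L) ^ j) (Mk (⟨d + 1, L, m, K, hd, hL⟩ : Params) j) (α + ε) T.emb + supNormL (((⟨d + 1, L, m, K, hd, hL⟩ : Params).L) ^ j) (Mk (⟨d + 1, L, m, K, hd, hL⟩ : Params) j) T.emb))
    (lam mu : Fin (d + 1)) (x : BondSpace (⟨d + 1, L, m, K, hd, hL⟩ : Params)) {X Xθ r : ℝ} (hX : 0 ≤ X) (hXθ : 0 ≤ Xθ)
    (y' : Site (⟨d + 1, L, m, K, hd, hL⟩ : Params) j)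
    (hsupp : ∀ b : PBond (⟨d + 1, L, m, K, hd, hL⟩ : Params) 0, x b ≠ 0 → torusSupNorm (Mk (⟨d + 1, L, m, K, hd, hL⟩ : Params) j) (rep (Mk (⟨d + 1, L, m, K, hd, hL⟩ : Params) j) (iterBlockOf j b.src) - rep (Mk (⟨d + 1, L, m, K, hd, hL⟩ : Params) j) y') ≤ r)
    (hx : ∀ b : PBond (⟨d + 1, L, m, K, hd, hL⟩ : Params) 0, |x b| ≤ X)
    (hH : ∀ b b' : PBond (⟨d + 1, L, m, K, hd, hL⟩ : Params) 0, b.dir = b'.dir → supDist b.src b'.src ≤ L ^ j →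
      |x b - x b'| ≤ Xθ * (((supDist b.src b'.src : ℕ) : ℝ) / (L : ℝ) ^ j) ^ (α + ε))
    (b₁ b₂ : PBond (⟨d + 1, L, m, K, hd, hL⟩ : Params) 0) (hdir : b₁.dir = b₂.dir)
    (hpos : 0 < distU (L ^ j) (Mk (⟨d + 1, L, m, K, hd, hL⟩ : Params) j) (EK hj' b₁.src) (EK hj' b₂.src))
    (hclose : distU (L ^ j) (Mk (⟨d + 1, L, m, K, hd, hL⟩ : Params) j) (EK hj' b₁.src) (EK hj' b₂.src) ≤ 1 / 4) :
    |(((((L : ℝ) ^ j) • (onE (LinearMap.funLeft ℝ ℝ (fun b : PBond (⟨d + 1, L, m, K, hd, hL⟩ : Params) 0 => (⟨b.src.shift mu, b.dir⟩ : PBond (⟨d + 1, L, m, K, hd, hL⟩ : Params) 0))) - LinearMap.id) : BondSpace (⟨d + 1, L, m, K, hd, hL⟩ : Params) →ₗ[ℝ] BondSpace (⟨d + 1, L, m, K, hd, hL⟩ : Params))) ∘ₗ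
      (GE (Domains.whole (P := (⟨d + 1, L, m, K, hd, hL⟩ : Params)) j hj') hc (w := fun _ => a * ((L : ℝ) ^ j) ^ (d + 1)) (fun _ => hw') ∘ₗ ((((L : ℝ) ^ j) • (onE (LinearMap.funLeft ℝ ℝ (fun b : PBond (⟨d + 1, L, m, K, hd, hL⟩ : Params) 0 => (⟨b.src.unshift lam, b.dir⟩ : PBond (⟨d + 1, L, m, K, hd, hL⟩ : Params) 0))) - LinearMap.id) : BondSpace (⟨d + 1, L, m, K, hd, hL⟩ : Params) →ₗ[ℝ] BondSpace (⟨d + 1, L, m, K, hd, hL⟩ : Params))))) x b₁ -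
      (((((L : ℝ) ^ j) • (onE (LinearMap.funLeft ℝ ℝ (fun b : PBond (⟨d + 1, L, m, K, hd, hL⟩ : Params) 0 => (⟨b.src.shift mu, b.dir⟩ : PBond (⟨d + 1, L, m, K, hd, hL⟩ : Params) 0))) - LinearMap.id) : BondSpace (⟨d + 1, L, m, K, hd, hL⟩ : Params) →ₗ[ℝ] BondSpace (⟨d + 1, L, m, K, hd, hL⟩ : Params))) ∘ₗ
      (GE (Domains.whole (P := (⟨d + 1, L, m, K, hd, hL⟩ : Params)) j hj') hc (w := fun _ => a * ((L : ℝ) ^ j) ^ (d + 1)) (fun _ => hw') ∘ₗ ((((L : ℝ) ^ j) • (onE (LinearMap.funLeft ℝ ℝ (fun b : PBond (⟨d + 1, L, m, K, hd, hL⟩ : Params) 0 => (⟨b.src.unshift lam, b.dir⟩ : PBond (⟨d + 1, L, m, K, hd, hL⟩ : Params) 0))) - LinearMap.id) : BondSpace (⟨d + 1, L, m, K, hd, hL⟩ : Params) →ₗ[ℝ] BondSpace (⟨d + 1, L, m, K, hd, hL⟩ : Params))))) x b₂| ≤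
      Cαε * (latticeConst (d + 1) 1 * Real.exp ((1 + δ) * (r + 3))) * ((Lθ (d + 1) + 1) * (max 1 (Lw (d + 1)) + 1) * Real.exp (3 * δ)) *
        Real.exp (-(δ * torusSupNorm (Mk (⟨d + 1, L, m, K, hd, hL⟩ : Params) j) (rep (Mk (⟨d + 1, L, m, K, hd, hL⟩ : Params) j) (iterBlockOf j b₁.src) - rep (Mk (⟨d + 1, L, m, K, hd, hL⟩ : Params) j) y'))) * (Xθ + X) *
        distU (L ^ j) (Mk (⟨d + 1, L, m, K, hd, hL⟩ : Params) j) (EK hj' b₁.src) (EK hj' b₂.src) ^ α := by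
  classical
  have hL0 : 0 < L := Nat.pos_of_ne_zero (NeZero.ne L)
  have hn1 : 1 ≤ L ^ j := Nat.one_le_pow _ _ hL0
  have hM2 : ∀ μ, 2 ≤ Mk (⟨d + 1, L, m, K, hd, hL⟩ : Params) j μ := two_le_Mk (⟨d + 1, L, m, K, hd, hL⟩ : Params) j
  have hαε0 : 0 < α + ε := by linarith
  have hle1 : distU (L ^ j) (Mk (⟨d + 1, L, m, K, hd, hL⟩ : Params) j) (EK hj' b₁.src) (EK hj' b₂.src) ≤ 1 := hclose.trans (by norm_num)
  -- abbreviations: the fine torus of scale `j`, the source, the field map, the two points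
  set M : Fin (d + 1) → ℕ := Mk (⟨d + 1, L, m, K, hd, hL⟩ : Params) j with hMdef
  set Tc : Fin (d + 1) → (Tor (fine (L ^ j) M) × Fin (d + 1) → ℂ) := fun ν b => ((if ν = lam then x ⟨(EK hj').symm b.1, b.2⟩ else 0 : ℝ) : ℂ) with hTc
  obtain ⟨T, hT⟩ : ∃ T : LocR (L ^ j) M, T = LocR.ten (fun ν b => if ν = lam then x ⟨(EK hj').symm b.1, b.2⟩ else 0) := ⟨_, rfl⟩
  have hTemb : T.emb = Loc189.ten Tc := by rw [hT]; rfl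
  set fld : (Fin (d + 1) → (Tor (fine (L ^ j) M) × Fin (d + 1) → ℂ)) → Fin (d + 1) → (Tor (fine (L ^ j) M) × Fin (d + 1) → ℂ) :=
    fun T' => B5Prop11Lattice.grad (L ^ j) M ((DeltaA (L ^ j) M a)⁻¹ *ᵥ divT (L ^ j) M T') with hfld
  -- §2 of file M1a: the difference of the two values is `Re` of the difference of two values of `fld Tc`
  have hval : (((((L : ℝ) ^ j) • (onE (LinearMap.funLeft ℝ ℝ (fun b : PBond (⟨d + 1, L, m, K, hd, hL⟩ : Params) 0 => (⟨b.src.shift mu, b.dir⟩ : PBond (⟨d + 1, L, m, K, hd, hL⟩ : Params) 0))) - LinearMap.id) : BondSpace (⟨d + 1, L, m, K, hd, hL⟩ : Params) →ₗ[ℝ] BondSpace (⟨d + 1, L, m, K, hd, hL⟩ : Params))) ∘ₗ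
      (GE (Domains.whole (P := (⟨d + 1, L, m, K, hd, hL⟩ : Params)) j hj') hc (w := fun _ => a * ((L : ℝ) ^ j) ^ (d + 1)) (fun _ => hw') ∘ₗ ((((L : ℝ) ^ j) • (onE (LinearMap.funLeft ℝ ℝ (fun b : PBond (⟨d + 1, L, m, K, hd, hL⟩ : Params) 0 => (⟨b.src.unshift lam, b.dir⟩ : PBond (⟨d + 1, L, m, K, hd, hL⟩ : Params) 0))) - LinearMap.id) : BondSpace (⟨d + 1, L, m, K, hd, hL⟩ : Params) →ₗ[ℝ] BondSpace (⟨d + 1, L, m, K, hd, hL⟩ : Params))))) x b₁ -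
      (((((L : ℝ) ^ j) • (onE (LinearMap.funLeft ℝ ℝ (fun b : PBond (⟨d + 1, L, m, K, hd, hL⟩ : Params) 0 => (⟨b.src.shift mu, b.dir⟩ : PBond (⟨d + 1, L, m, K, hd, hL⟩ : Params) 0))) - LinearMap.id) : BondSpace (⟨d + 1, L, m, K, hd, hL⟩ : Params) →ₗ[ℝ] BondSpace (⟨d + 1, L, m, K, hd, hL⟩ : Params))) ∘ₗ
      (GE (Domains.whole (P := (⟨d + 1, L, m, K, hd, hL⟩ : Params)) j hj') hc (w := fun _ => a * ((L : ℝ) ^ j) ^ (d + 1)) (fun _ => hw') ∘ₗ ((((L : ℝ) ^ j) • (onE (LinearMap.funLeft ℝ ℝ (fun b : PBond (⟨d + 1, L, m, K, hd, hL⟩ : Params) 0 => (⟨b.src.unshift lam, b.dir⟩ : PBond (⟨d + 1, L, m, K, hd, hL⟩ : Params) 0))) - LinearMap.id) : BondSpace (⟨d + 1, L, m, K, hd, hL⟩ : Params) →ₗ[ℝ] BondSpace (⟨d + 1, L, m, K, hd, hL⟩ : Params))))) x b₂ =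
      (fld Tc mu (EK hj' b₁.src, b₁.dir) - fld Tc mu (EK hj' b₂.src, b₂.dir)).re := by
    rw [DGEDadj_apply_eq hj' hc ha hw', DGEDadj_apply_eq hj' hc ha hw', Complex.sub_re]
  -- the pieces (file M1b §4) and the linearity of `fld`
  have hfld_add : ∀ (s : Finset (Site (⟨d + 1, L, m, K, hd, hL⟩ : Params) j)) (Tz : Site (⟨d + 1, L, m, K, hd, hL⟩ : Params) j → Fin (d + 1) → (Tor (fine (L ^ j) M) × Fin (d + 1) → ℂ)),
      fld (∑ z ∈ s, Tz z) = ∑ z ∈ s, fld (Tz z) := by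
    intro s Tz
    simp only [hfld]
    rw [divT_sum, mulVec_finset_sum', grad_sum]
  have hdecomp : Tc = ∑ z : Site (⟨d + 1, L, m, K, hd, hL⟩ : Params) j, smulT (L ^ j) M (wP M (L ^ j) z) Tc :=
    (sum_pieces_ten M (L ^ j) hM2 Tc).symm
  have hpiece : ∀ z : Site (⟨d + 1, L, m, K, hd, hL⟩ : Params) j, smulT (L ^ j) M (wP M (L ^ j) z) Tc =
      fun ν b => (((wP M (L ^ j) z b.1 * (if ν = lam then x ⟨(EK hj').symm b.1, b.2⟩ else 0) : ℝ) : ℂ)) := by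
    intro z; funext ν b; simp only [smulT, hTc, Complex.ofReal_mul]
  have hsum : fld Tc mu (EK hj' b₁.src, b₁.dir) - fld Tc mu (EK hj' b₂.src, b₂.dir) =
      ∑ z : Site (⟨d + 1, L, m, K, hd, hL⟩ : Params) j, (fld (smulT (L ^ j) M (wP M (L ^ j) z) Tc) mu (EK hj' b₁.src, b₁.dir) - fld (smulT (L ^ j) M (wP M (L ^ j) z) Tc) mu (EK hj' b₂.src, b₂.dir)) := by
    rw [Finset.sum_sub_distrib]
    conv_lhs => rw [hdecomp]
    rw [hfld_add]
    simp only [Finset.sum_apply]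
  -- the plateau cut-off around `EK x` covers both points
  set χ : Tor (fine (L ^ j) M) → ℝ := cutP M (L ^ j) (nearOf M (L ^ j) (EK hj' b₁.src)) with hχ
  have hχ1 : χ (EK hj' b₁.src) = 1 := cutP_nearOf_eq_one M (L ^ j) hn1 (EK hj' b₁.src)
  have hχ2 : χ (EK hj' b₂.src) = 1 := cutP_nearOf_eq_one_of_distU_le M (L ^ j) hn1 hclose
  have hcut : cutHL (L ^ j) M α χ ≤ Lθ (d + 1) + 1 := cutH_le M (L ^ j) hM2 α _ hα1
  have hcut0 : 0 ≤ cutHL (L ^ j) M α χ := B5Prop12FieldsLattice.cutHL_nonneg α χ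
  have hLθ : 0 ≤ Lθ (d + 1) := Lθ_nonneg (d + 1)
  have hD : 0 < distU (L ^ j) M (EK hj' b₁.src) (EK hj' b₂.src) ^ α := Real.rpow_pos_of_pos hpos α
  -- the anchor: `|ỹ − y(x)| ≤ 3`, `ỹ = nearOf (EK x)`, so `e^{−δ|ỹ − z|} ≤ e^{3δ}e^{−δ|y(x) − z|}`
  have hyn : distSite M (iterBlockOf j b₁.src) (nearOf M (L ^ j) (EK hj' b₁.src)) ≤ 3 :=
    distSite_le_three_of_mem_mem hn1 (EK_mem_cubeT_blk hj' b₁.src) (mem_cubeT_nearOf M (L ^ j) hn1 (EK hj' b₁.src))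
  have hexp : ∀ z : Site (⟨d + 1, L, m, K, hd, hL⟩ : Params) j, Real.exp (-(δ * distSite M (nearOf M (L ^ j) (EK hj' b₁.src)) z)) ≤
      Real.exp (3 * δ) * Real.exp (-(δ * torusSupNorm (Mk (⟨d + 1, L, m, K, hd, hL⟩ : Params) j) (rep (Mk (⟨d + 1, L, m, K, hd, hL⟩ : Params) j) (iterBlockOf j b₁.src) - rep (Mk (⟨d + 1, L, m, K, hd, hL⟩ : Params) j) z))) := by
    intro z
    have hdist : distSite M (iterBlockOf j b₁.src) z = torusSupNorm (Mk (⟨d + 1, L, m, K, hd, hL⟩ : Params) j) (rep (Mk (⟨d + 1, L, m, K, hd, hL⟩ : Params) j) (iterBlockOf j b₁.src) - rep (Mk (⟨d + 1, L, m, K, hd, hL⟩ : Params) j) z) := by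
      rw [← supDist_cast_eq_distSite, supDist_cast_eq_torusSupNorm]
    rw [← Real.exp_add, ← hdist]
    apply Real.exp_le_exp.mpr
    have ht := distSite_triangle M (iterBlockOf j b₁.src) (nearOf M (L ^ j) (EK hj' b₁.src)) z
    nlinarith
  -- the sizes of the whole source
  have h5 : holderL (L ^ j) M (α + ε) T.emb ≤ Xθ := by rw [hT]; exact holderL_srcT_le hj' lam x hXθ hH
  have h6 : supNormL (L ^ j) M T.emb ≤ X := by rw [hT]; exact supNormL_srcT_le hj' lam x hX hx
  -- each piece: the pair is a pair of the cut field `χ∇(Δ_a⁻¹∇*ζ′_zT)`, below its Hölder seminorm = (1.113) at `(ỹ, z)`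
  have hz_bound : ∀ z : Site (⟨d + 1, L, m, K, hd, hL⟩ : Params) j,
      ‖fld (smulT (L ^ j) M (wP M (L ^ j) z) Tc) mu (EK hj' b₁.src, b₁.dir) - fld (smulT (L ^ j) M (wP M (L ^ j) z) Tc) mu (EK hj' b₂.src, b₂.dir)‖ ≤
        Cαε * Real.exp (3 * δ) * Real.exp (-(δ * torusSupNorm (Mk (⟨d + 1, L, m, K, hd, hL⟩ : Params) j) (rep (Mk (⟨d + 1, L, m, K, hd, hL⟩ : Params) j) (iterBlockOf j b₁.src) - rep (Mk (⟨d + 1, L, m, K, hd, hL⟩ : Params) j) z))) *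
          ((Lθ (d + 1) + 1) * ((max 1 (Lw (d + 1)) + 1) * (Xθ + X))) * distU (L ^ j) M (EK hj' b₁.src) (EK hj' b₂.src) ^ α := by
    intro z
    obtain ⟨Tz, hTz⟩ : ∃ Tz : LocR (L ^ j) M, Tz = LocR.ten (fun ν b => wP M (L ^ j) z b.1 * (if ν = lam then x ⟨(EK hj').symm b.1, b.2⟩ else 0)) := ⟨_, rfl⟩
    have hTz_emb : Tz.emb = pieceL M (L ^ j) z T.emb := by rw [hTz, hT, pieceL_srcT_eq hj']
    have hTz_ten : Tz.emb = Loc189.ten (smulT (L ^ j) M (wP M (L ^ j) z) Tc) := by rw [hTz, hpiece z]; rfl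
    set Fz : Fin (d + 1) → (Tor (fine (L ^ j) M) × Fin (d + 1) → ℂ) := fld (smulT (L ^ j) M (wP M (L ^ j) z) Tc) with hFz
    -- the pair as a pair of the cut field `χF_z`
    have hpair := holder_bound (adm := fun p p' : Fin (d + 1) × (Tor (fine (L ^ j) M) × Fin (d + 1)) =>
        (p.1 = p'.1 ∧ p.2.2 = p'.2.2) ∧ distU (L ^ j) M p.2.1 p'.2.1 ≤ 1)
      (dist := fun p p' : Fin (d + 1) × (Tor (fine (L ^ j) M) × Fin (d + 1)) => distU (L ^ j) M p.2.1 p'.2.1)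
      (τ := fun _ _ => id) (S := Finset.univ) (α := α)
      (fun p : Fin (d + 1) × (Tor (fine (L ^ j) M) × Fin (d + 1)) => smulT (L ^ j) M χ Fz p.1 p.2)
      (x := (mu, (EK hj' b₁.src, b₁.dir))) (x' := (mu, (EK hj' b₂.src, b₂.dir))) (Finset.mem_univ _) (Finset.mem_univ _)
      ⟨⟨rfl, hdir⟩, hle1⟩ hpos
    dsimp only [id] at hpair
    -- `hpair : ‖χ(EK x′)F_z(EK x′, ν) − χ(EK x)F_z(EK x, ν)‖ ≤ holderT α (χF_z) * distU^α`
    have h2 : Fz mu (EK hj' b₁.src, b₁.dir) - Fz mu (EK hj' b₂.src, b₂.dir) =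
        -(smulT (L ^ j) M χ Fz mu (EK hj' b₂.src, b₂.dir) - smulT (L ^ j) M χ Fz mu (EK hj' b₁.src, b₁.dir)) := by
      simp only [smulT, hχ1, hχ2, Complex.ofReal_one, one_mul, neg_sub]
    have h1 : ‖Fz mu (EK hj' b₁.src, b₁.dir) - Fz mu (EK hj' b₂.src, b₂.dir)‖ ≤
        h2L (L ^ j) M a Tz.emb α χ * distU (L ^ j) M (EK hj' b₁.src) (EK hj' b₂.src) ^ α := by
      rw [h2, norm_neg, hTz_ten, B5Prop12FieldsLattice.h2L_ten]
      exact hpair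
    -- (1.113) for the piece at `(ỹ, z)`
    have h3 := H Tz χ (nearOf M (L ^ j) (EK hj' b₁.src)) z (cutInL_cutP M (L ^ j) hn1 _) (by rw [hTz_emb]; exact piece_supp M (L ^ j) z T.emb)
    -- the sizes of the piece
    have h4 : holderL (L ^ j) M (α + ε) Tz.emb ≤ max 1 (Lw (d + 1)) * (holderL (L ^ j) M (α + ε) T.emb + supNormL (L ^ j) M T.emb) := by
      rw [hTz_emb]; exact piece_holder M (L ^ j) hM2 (α + ε) T.emb z hαε0 hαε
    have h4' : supNormL (L ^ j) M Tz.emb ≤ supNormL (L ^ j) M T.emb := by rw [hTz_emb]; exact piece_sup M (L ^ j) z T.emb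
    have h7 : holderL (L ^ j) M (α + ε) Tz.emb + supNormL (L ^ j) M Tz.emb ≤ (max 1 (Lw (d + 1)) + 1) * (Xθ + X) := by
      have hm1 : (1 : ℝ) ≤ max 1 (Lw (d + 1)) := le_max_left _ _
      have hHo : 0 ≤ holderL (L ^ j) M (α + ε) T.emb := B5Prop12FieldsLattice.holderL_nonneg _ _
      have hSo : 0 ≤ supNormL (L ^ j) M T.emb := B5Prop12FieldsLattice.supNormL_nonneg _
      nlinarith
    have h8 : h2L (L ^ j) M a Tz.emb α χ ≤ Cαε * Real.exp (3 * δ) * Real.exp (-(δ * torusSupNorm (Mk (⟨d + 1, L, m, K, hd, hL⟩ : Params) j) (rep (Mk (⟨d + 1, L, m, K, hd, hL⟩ : Params) j) (iterBlockOf j b₁.src) - rep (Mk (⟨d + 1, L, m, K, hd, hL⟩ : Params) j) z))) *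
        ((Lθ (d + 1) + 1) * ((max 1 (Lw (d + 1)) + 1) * (Xθ + X))) := by
      refine h3.trans ?_
      have hN : 0 ≤ holderL (L ^ j) M (α + ε) Tz.emb + supNormL (L ^ j) M Tz.emb :=
        add_nonneg (B5Prop12FieldsLattice.holderL_nonneg _ _) (B5Prop12FieldsLattice.supNormL_nonneg _)
      calc Cαε * Real.exp (-(δ * distSite M (nearOf M (L ^ j) (EK hj' b₁.src)) z)) * cutHL (L ^ j) M α χ *
            (holderL (L ^ j) M (α + ε) Tz.emb + supNormL (L ^ j) M Tz.emb)
          ≤ Cαε * (Real.exp (3 * δ) * Real.exp (-(δ * torusSupNorm (Mk (⟨d + 1, L, m, K, hd, hL⟩ : Params) j) (rep (Mk (⟨d + 1, L, m, K, hd, hL⟩ : Params) j) (iterBlockOf j b₁.src) - rep (Mk (⟨d + 1, L, m, K, hd, hL⟩ : Params) j) z)))) * (Lθ (d + 1) + 1) *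
            ((max 1 (Lw (d + 1)) + 1) * (Xθ + X)) := by
              have hLw := Lw_nonneg (d + 1)
              gcongr
              exact hexp z
        _ = _ := by ring
    have hCE : 0 ≤ Cαε * Real.exp (3 * δ) * Real.exp (-(δ * torusSupNorm (Mk (⟨d + 1, L, m, K, hd, hL⟩ : Params) j) (rep (Mk (⟨d + 1, L, m, K, hd, hL⟩ : Params) j) (iterBlockOf j b₁.src) - rep (Mk (⟨d + 1, L, m, K, hd, hL⟩ : Params) j) z))) *
        ((Lθ (d + 1) + 1) * ((max 1 (Lw (d + 1)) + 1) * (Xθ + X))) := by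
      have hLw := Lw_nonneg (d + 1)
      positivity
    exact h1.trans (mul_le_mul_of_nonneg_right h8 hD.le)
  -- far pieces vanish at both points
  have hz_far : ∀ z : Site (⟨d + 1, L, m, K, hd, hL⟩ : Params) j, ¬ torusSupNorm (Mk (⟨d + 1, L, m, K, hd, hL⟩ : Params) j) (rep (Mk (⟨d + 1, L, m, K, hd, hL⟩ : Params) j) z - rep (Mk (⟨d + 1, L, m, K, hd, hL⟩ : Params) j) y') ≤ r + 3 →
      ‖fld (smulT (L ^ j) M (wP M (L ^ j) z) Tc) mu (EK hj' b₁.src, b₁.dir) - fld (smulT (L ^ j) M (wP M (L ^ j) z) Tc) mu (EK hj' b₂.src, b₂.dir)‖ = 0 := by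
    intro z hz
    rw [hpiece z, srcPiece_eq_zero_of_far hj' lam x y' hsupp z hz]
    simp only [hfld]
    rw [grad_G_divT_zero]
    simp
  -- assemble
  rw [hval]
  calc |(fld Tc mu (EK hj' b₁.src, b₁.dir) - fld Tc mu (EK hj' b₂.src, b₂.dir)).re|
      ≤ ‖fld Tc mu (EK hj' b₁.src, b₁.dir) - fld Tc mu (EK hj' b₂.src, b₂.dir)‖ := Complex.abs_re_le_norm _
    _ = ‖∑ z : Site (⟨d + 1, L, m, K, hd, hL⟩ : Params) j, (fld (smulT (L ^ j) M (wP M (L ^ j) z) Tc) mu (EK hj' b₁.src, b₁.dir) - fld (smulT (L ^ j) M (wP M (L ^ j) z) Tc) mu (EK hj' b₂.src, b₂.dir))‖ := by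
        rw [hsum]
    _ ≤ ∑ z : Site (⟨d + 1, L, m, K, hd, hL⟩ : Params) j, ‖fld (smulT (L ^ j) M (wP M (L ^ j) z) Tc) mu (EK hj' b₁.src, b₁.dir) - fld (smulT (L ^ j) M (wP M (L ^ j) z) Tc) mu (EK hj' b₂.src, b₂.dir)‖ :=
        norm_sum_le _ _
    _ = ∑ z ∈ univ.filter (fun z : Site (⟨d + 1, L, m, K, hd, hL⟩ : Params) j => torusSupNorm (Mk (⟨d + 1, L, m, K, hd, hL⟩ : Params) j) (rep (Mk (⟨d + 1, L, m, K, hd, hL⟩ : Params) j) z - rep (Mk (⟨d + 1, L, m, K, hd, hL⟩ : Params) j) y') ≤ r + 3),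
          ‖fld (smulT (L ^ j) M (wP M (L ^ j) z) Tc) mu (EK hj' b₁.src, b₁.dir) - fld (smulT (L ^ j) M (wP M (L ^ j) z) Tc) mu (EK hj' b₂.src, b₂.dir)‖ := by
        rw [← Finset.sum_filter_add_sum_filter_not univ (fun z : Site (⟨d + 1, L, m, K, hd, hL⟩ : Params) j => torusSupNorm (Mk (⟨d + 1, L, m, K, hd, hL⟩ : Params) j) (rep (Mk (⟨d + 1, L, m, K, hd, hL⟩ : Params) j) z - rep (Mk (⟨d + 1, L, m, K, hd, hL⟩ : Params) j) y') ≤ r + 3)]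
        rw [Finset.sum_eq_zero (s := univ.filter (fun z : Site (⟨d + 1, L, m, K, hd, hL⟩ : Params) j => ¬ torusSupNorm (Mk (⟨d + 1, L, m, K, hd, hL⟩ : Params) j) (rep (Mk (⟨d + 1, L, m, K, hd, hL⟩ : Params) j) z - rep (Mk (⟨d + 1, L, m, K, hd, hL⟩ : Params) j) y') ≤ r + 3))
          (fun z hz => hz_far z (Finset.mem_filter.mp hz).2), add_zero]
    _ ≤ ∑ z ∈ univ.filter (fun z : Site (⟨d + 1, L, m, K, hd, hL⟩ : Params) j => torusSupNorm (Mk (⟨d + 1, L, m, K, hd, hL⟩ : Params) j) (rep (Mk (⟨d + 1, L, m, K, hd, hL⟩ : Params) j) z - rep (Mk (⟨d + 1, L, m, K, hd, hL⟩ : Params) j) y') ≤ r + 3),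
          Cαε * Real.exp (3 * δ) * Real.exp (-(δ * torusSupNorm (Mk (⟨d + 1, L, m, K, hd, hL⟩ : Params) j) (rep (Mk (⟨d + 1, L, m, K, hd, hL⟩ : Params) j) (iterBlockOf j b₁.src) - rep (Mk (⟨d + 1, L, m, K, hd, hL⟩ : Params) j) z))) *
            ((Lθ (d + 1) + 1) * ((max 1 (Lw (d + 1)) + 1) * (Xθ + X))) * distU (L ^ j) M (EK hj' b₁.src) (EK hj' b₂.src) ^ α :=
        Finset.sum_le_sum fun z _ => hz_bound z
    _ = Cαε * Real.exp (3 * δ) * ((Lθ (d + 1) + 1) * ((max 1 (Lw (d + 1)) + 1) * (Xθ + X))) * distU (L ^ j) M (EK hj' b₁.src) (EK hj' b₂.src) ^ α *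
          ∑ z ∈ univ.filter (fun z : Site (⟨d + 1, L, m, K, hd, hL⟩ : Params) j => torusSupNorm (Mk (⟨d + 1, L, m, K, hd, hL⟩ : Params) j) (rep (Mk (⟨d + 1, L, m, K, hd, hL⟩ : Params) j) z - rep (Mk (⟨d + 1, L, m, K, hd, hL⟩ : Params) j) y') ≤ r + 3),
            Real.exp (-(δ * torusSupNorm (Mk (⟨d + 1, L, m, K, hd, hL⟩ : Params) j) (rep (Mk (⟨d + 1, L, m, K, hd, hL⟩ : Params) j) (iterBlockOf j b₁.src) - rep (Mk (⟨d + 1, L, m, K, hd, hL⟩ : Params) j) z))) := by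
        rw [Finset.mul_sum]
        exact Finset.sum_congr rfl fun z _ => by ring
    _ ≤ Cαε * Real.exp (3 * δ) * ((Lθ (d + 1) + 1) * ((max 1 (Lw (d + 1)) + 1) * (Xθ + X))) * distU (L ^ j) M (EK hj' b₁.src) (EK hj' b₂.src) ^ α *
          (latticeConst (d + 1) 1 * Real.exp ((1 + δ) * (r + 3)) * Real.exp (-(δ * torusSupNorm (Mk (⟨d + 1, L, m, K, hd, hL⟩ : Params) j) (rep (Mk (⟨d + 1, L, m, K, hd, hL⟩ : Params) j) (iterBlockOf j b₁.src) - rep (Mk (⟨d + 1, L, m, K, hd, hL⟩ : Params) j) y')))) := by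
        have hLw := Lw_nonneg (d + 1)
        exact mul_le_mul_of_nonneg_left (sum_ball_exp_le (hd := hd) (hL := hL) (iterBlockOf j b₁.src) y' hδ) (by positivity)
    _ = _ := by ring

end Transport

/-! ## §3  Uniform constants: all volumes, all scales, all pairs -/

variable {d L m K : ℕ} {hd : 1 ≤ d + 1} {hL : Odd L ∧ 1 < L} {j : ℕ}

/-- far pairs, bookkeeping: two sup bounds `S₁ ≤ C e^{−δρ₁}`, `S₂ ≤ C e^{−δρ₂}` with `ρ₁ ≤ ρ₂ + 1` and `1 ≤ 4t^α` give
`S₁ + S₂ ≤ 4C(1 + e^δ)·e^{−δρ₁}·t^α` (`C, δ ≥ 0`). [cite: Balaban1984PropagatorsI, (1.113) p.36 (constants bookkeeping, ours)] -/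
private theorem far_pair_le {S₁ S₂ C δ ρ₁ ρ₂ tα : ℝ} (hC : 0 ≤ C) (hδ : 0 ≤ δ) (h1 : S₁ ≤ C * Real.exp (-(δ * ρ₁))) (h2 : S₂ ≤ C * Real.exp (-(δ * ρ₂)))
    (hρ : ρ₁ ≤ ρ₂ + 1) (ht : 1 ≤ 4 * tα) : S₁ + S₂ ≤ 4 * C * (1 + Real.exp δ) * Real.exp (-(δ * ρ₁)) * tα := by
  have e2 : Real.exp (-(δ * ρ₂)) ≤ Real.exp δ * Real.exp (-(δ * ρ₁)) := by
    rw [← Real.exp_add]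
    exact Real.exp_le_exp.mpr (by nlinarith)
  have h12 : S₁ + S₂ ≤ C * (1 + Real.exp δ) * Real.exp (-(δ * ρ₁)) := by
    have := mul_le_mul_of_nonneg_left e2 hC
    nlinarith
  have h0 : 0 ≤ C * (1 + Real.exp δ) * Real.exp (-(δ * ρ₁)) := by positivity
  calc S₁ + S₂ ≤ C * (1 + Real.exp δ) * Real.exp (-(δ * ρ₁)) * 1 := by rw [mul_one]; exact h12
    _ ≤ C * (1 + Real.exp δ) * Real.exp (-(δ * ρ₁)) * (4 * tα) := mul_le_mul_of_nonneg_left ht h0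
    _ = _ := by ring

open Classical in
/-- **[4] PROPOSITION 1.2, THE MEMBER (1.113), FOR `∇_μG^{(w′)}∇_λ*` AS A PAIR BOUND WITH HÖLDER INPUT, UNIFORMLY** (`c = L^j`, `w′ = a·n^{d+1}`): there is
`δ₀ > 0` depending on `d, L, a` only and, for every rate `0 < δ ≤ δ₀` and every `0 ≤ α`, `0 < ε` with `α + ε < 1`, a `C ≥ 0` such that for every volume
`(m, K)`, every `j ≤ m + K`, all directions `λ, μ`, every radius `r`, every unit site `y′`, every fine bond field `x` supported over the unit sites within
`r` of `y′` with `|x| ≤ X` and `|x(b) − x(b′)| ≤ X_θ(|b₋ − b₋′|_∞/L^j)^{α+ε}` on same-direction pairs at `|b₋ − b₋′|_∞ ≤ L^j`, and all fine bonds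
`b₁ = ⟨x, ν⟩`, `b₂ = ⟨x′, ν⟩` with `|x − x′|_∞ ≤ L^j`:
`|(∇_μG^{(w′)}∇_λ*x)(b₁) − (∇_μG^{(w′)}∇_λ*x)(b₂)| ≤ C·e^{(1+δ)(r+3)}·e^{−δ|y(x) − y′|_T}·(X_θ + X)·(|x − x′|_∞/L^j)^α` — close pairs (`t ≤ ¼`, forcing
`j ≥ 1`) by §2 fed with §1, far pairs (`¼ < t ≤ 1`, `t^{−α} ≤ 4`) by file M1b's cube-sup bound (1.112) at both bonds with the input exponent `α + ε`
(`|y(x) − y(x′)| ≤ 1`). [cite: Balaban1984PropagatorsI, Prop. 1.2 (1.113) p.36; Balaban1984PropagatorsII, Prop. 2.5 p.246 («They follow from the Proposition 1.2»)] -/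
theorem pair113_DGEDadj_scaling (d L : ℕ) (hd : 1 ≤ d + 1) (hL : Odd L ∧ 1 < L) {a : ℝ} (ha : 0 < a) :
    ∃ δ₀ : ℝ, 0 < δ₀ ∧ ∀ δ : ℝ, 0 < δ → δ ≤ δ₀ → ∀ α ε : ℝ, 0 ≤ α → 0 < ε → α + ε < 1 → ∃ C : ℝ, 0 ≤ C ∧ ∀ (m K j : ℕ)
      (hj' : j ≤ (⟨d + 1, L, m, K, hd, hL⟩ : Params).m + (⟨d + 1, L, m, K, hd, hL⟩ : Params).K) (hc : ((L : ℝ) ^ j) ≠ 0)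
      (hw' : (0 : ℝ) < a * ((L : ℝ) ^ j) ^ (d + 1)) (lam mu : Fin (d + 1))
      (x : BondSpace (⟨d + 1, L, m, K, hd, hL⟩ : Params)) (X Xθ r : ℝ) (_ : 0 ≤ X) (_ : 0 ≤ Xθ)
      (y' : Site (⟨d + 1, L, m, K, hd, hL⟩ : Params) j)
      (_ : ∀ b : PBond (⟨d + 1, L, m, K, hd, hL⟩ : Params) 0, x b ≠ 0 → torusSupNorm (Mk (⟨d + 1, L, m, K, hd, hL⟩ : Params) j) (rep (Mk (⟨d + 1, L, m, K, hd, hL⟩ : Params) j) (iterBlockOf j b.src) - rep (Mk (⟨d + 1, L, m, K, hd, hL⟩ : Params) j) y') ≤ r)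
      (_ : ∀ b : PBond (⟨d + 1, L, m, K, hd, hL⟩ : Params) 0, |x b| ≤ X)
      (_ : ∀ b b' : PBond (⟨d + 1, L, m, K, hd, hL⟩ : Params) 0, b.dir = b'.dir → supDist b.src b'.src ≤ L ^ j →
        |x b - x b'| ≤ Xθ * (((supDist b.src b'.src : ℕ) : ℝ) / (L : ℝ) ^ j) ^ (α + ε))
      (b₁ b₂ : PBond (⟨d + 1, L, m, K, hd, hL⟩ : Params) 0) (_ : b₁.dir = b₂.dir) (_ : supDist b₁.src b₂.src ≤ L ^ j),
      |(((((L : ℝ) ^ j) • (onE (LinearMap.funLeft ℝ ℝ (fun b : PBond (⟨d + 1, L, m, K, hd, hL⟩ : Params) 0 => (⟨b.src.shift mu, b.dir⟩ : PBond (⟨d + 1, L, m, K, hd, hL⟩ : Params) 0))) - LinearMap.id) : BondSpace (⟨d + 1, L, m, K, hd, hL⟩ : Params) →ₗ[ℝ] BondSpace (⟨d + 1, L, m, K, hd, hL⟩ : Params))) ∘ₗ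
      (GE (Domains.whole (P := (⟨d + 1, L, m, K, hd, hL⟩ : Params)) j hj') hc (w := fun _ => a * ((L : ℝ) ^ j) ^ (d + 1)) (fun _ => hw') ∘ₗ ((((L : ℝ) ^ j) • (onE (LinearMap.funLeft ℝ ℝ (fun b : PBond (⟨d + 1, L, m, K, hd, hL⟩ : Params) 0 => (⟨b.src.unshift lam, b.dir⟩ : PBond (⟨d + 1, L, m, K, hd, hL⟩ : Params) 0))) - LinearMap.id) : BondSpace (⟨d + 1, L, m, K, hd, hL⟩ : Params) →ₗ[ℝ] BondSpace (⟨d + 1, L, m, K, hd, hL⟩ : Params))))) x b₁ -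
        (((((L : ℝ) ^ j) • (onE (LinearMap.funLeft ℝ ℝ (fun b : PBond (⟨d + 1, L, m, K, hd, hL⟩ : Params) 0 => (⟨b.src.shift mu, b.dir⟩ : PBond (⟨d + 1, L, m, K, hd, hL⟩ : Params) 0))) - LinearMap.id) : BondSpace (⟨d + 1, L, m, K, hd, hL⟩ : Params) →ₗ[ℝ] BondSpace (⟨d + 1, L, m, K, hd, hL⟩ : Params))) ∘ₗ
      (GE (Domains.whole (P := (⟨d + 1, L, m, K, hd, hL⟩ : Params)) j hj') hc (w := fun _ => a * ((L : ℝ) ^ j) ^ (d + 1)) (fun _ => hw') ∘ₗ ((((L : ℝ) ^ j) • (onE (LinearMap.funLeft ℝ ℝ (fun b : PBond (⟨d + 1, L, m, K, hd, hL⟩ : Params) 0 => (⟨b.src.unshift lam, b.dir⟩ : PBond (⟨d + 1, L, m, K, hd, hL⟩ : Params) 0))) - LinearMap.id) : BondSpace (⟨d + 1, L, m, K, hd, hL⟩ : Params) →ₗ[ℝ] BondSpace (⟨d + 1, L, m, K, hd, hL⟩ : Params))))) x b₂| ≤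
        C * Real.exp ((1 + δ) * (r + 3)) * Real.exp (-(δ * torusSupNorm (Mk (⟨d + 1, L, m, K, hd, hL⟩ : Params) j) (rep (Mk (⟨d + 1, L, m, K, hd, hL⟩ : Params) j) (iterBlockOf j b₁.src) - rep (Mk (⟨d + 1, L, m, K, hd, hL⟩ : Params) j) y'))) * (Xθ + X) *
          (((supDist b₁.src b₂.src : ℕ) : ℝ) / (L : ℝ) ^ j) ^ α := by
  obtain ⟨δH, hδH, Cαε, HH⟩ := h2L_allScales (d + 1) L ha
  obtain ⟨δS, hδS, HS⟩ := cubeSup112_DGEDadj_scaling d L hd hL ha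
  refine ⟨min δH δS, lt_min hδH hδS, fun δ hδ hδδ₀ α ε hα0 hε0 hαε => ?_⟩
  have hδH' : δ ≤ δH := hδδ₀.trans (min_le_left _ _)
  have hδS' : δ ≤ δS := hδδ₀.trans (min_le_right _ _)
  have hαε0 : 0 < α + ε := by linarith
  obtain ⟨CS, hCS, hS⟩ := HS δ hδ hδS' (α + ε) hαε0 hαε
  have hLθ : 0 ≤ Lθ (d + 1) := Lθ_nonneg (d + 1)
  have hLw : 0 ≤ Lw (d + 1) := Lw_nonneg (d + 1)
  have hK10 : 0 ≤ latticeConst (d + 1) 1 := latticeConst_nonneg _ zero_le_one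
  have hm : 0 ≤ max (Cαε α ε) 0 := le_max_right _ _
  refine ⟨max (Cαε α ε) 0 * latticeConst (d + 1) 1 * ((Lθ (d + 1) + 1) * (max 1 (Lw (d + 1)) + 1) * Real.exp (3 * δ)) + 4 * CS * (1 + Real.exp δ),
    by positivity, ?_⟩
  intro m K j hj' hc hw' lam mu x X Xθ r hX hXθ y' hsupp hx hH b₁ b₂ hdir hle
  have hL0 : 0 < L := by have := hL.2; omega
  haveI : NeZero L := ⟨by omega⟩
  have hLj : (0 : ℝ) < (L : ℝ) ^ j := by positivity
  have hρ : IsPseudoDist (fun t t' : Site (⟨d + 1, L, m, K, hd, hL⟩ : Params) j => torusSupNorm (Mk (⟨d + 1, L, m, K, hd, hL⟩ : Params) j) (rep (Mk (⟨d + 1, L, m, K, hd, hL⟩ : Params) j) t - rep (Mk (⟨d + 1, L, m, K, hd, hL⟩ : Params) j) t')) := torusDist_isPseudoDist (Mk (⟨d + 1, L, m, K, hd, hL⟩ : Params) j)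
  set t : ℝ := (((supDist b₁.src b₂.src : ℕ) : ℝ) / (L : ℝ) ^ j) with ht
  have ht0 : 0 ≤ t := by positivity
  have ht1 : t ≤ 1 := by rw [ht, div_le_one hLj]; exact_mod_cast hle
  have htα : 0 ≤ t ^ α := Real.rpow_nonneg ht0 α
  have hdU : distU (L ^ j) (Mk (⟨d + 1, L, m, K, hd, hL⟩ : Params) j) (EK hj' b₁.src) (EK hj' b₂.src) = t := by rw [ht]; exact distU_EK hj' b₁.src b₂.src
  have hXX : 0 ≤ Xθ + X := add_nonneg hXθ hX
  have hE0 : 0 ≤ Real.exp ((1 + δ) * (r + 3)) * Real.exp (-(δ * torusSupNorm (Mk (⟨d + 1, L, m, K, hd, hL⟩ : Params) j) (rep (Mk (⟨d + 1, L, m, K, hd, hL⟩ : Params) j) (iterBlockOf j b₁.src) - rep (Mk (⟨d + 1, L, m, K, hd, hL⟩ : Params) j) y'))) * (Xθ + X) * t ^ α := by positivity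
  -- weakening to the common constant
  have weak : ∀ {Cb : ℝ}, Cb ≤ max (Cαε α ε) 0 * latticeConst (d + 1) 1 * ((Lθ (d + 1) + 1) * (max 1 (Lw (d + 1)) + 1) * Real.exp (3 * δ)) + 4 * CS * (1 + Real.exp δ) →
      Cb * Real.exp ((1 + δ) * (r + 3)) * Real.exp (-(δ * torusSupNorm (Mk (⟨d + 1, L, m, K, hd, hL⟩ : Params) j) (rep (Mk (⟨d + 1, L, m, K, hd, hL⟩ : Params) j) (iterBlockOf j b₁.src) - rep (Mk (⟨d + 1, L, m, K, hd, hL⟩ : Params) j) y'))) * (Xθ + X) * t ^ α ≤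
        (max (Cαε α ε) 0 * latticeConst (d + 1) 1 * ((Lθ (d + 1) + 1) * (max 1 (Lw (d + 1)) + 1) * Real.exp (3 * δ)) + 4 * CS * (1 + Real.exp δ)) *
          Real.exp ((1 + δ) * (r + 3)) * Real.exp (-(δ * torusSupNorm (Mk (⟨d + 1, L, m, K, hd, hL⟩ : Params) j) (rep (Mk (⟨d + 1, L, m, K, hd, hL⟩ : Params) j) (iterBlockOf j b₁.src) - rep (Mk (⟨d + 1, L, m, K, hd, hL⟩ : Params) j) y'))) * (Xθ + X) * t ^ α := by
    intro Cb hCC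
    have e : ∀ c : ℝ, c * Real.exp ((1 + δ) * (r + 3)) * Real.exp (-(δ * torusSupNorm (Mk (⟨d + 1, L, m, K, hd, hL⟩ : Params) j) (rep (Mk (⟨d + 1, L, m, K, hd, hL⟩ : Params) j) (iterBlockOf j b₁.src) - rep (Mk (⟨d + 1, L, m, K, hd, hL⟩ : Params) j) y'))) * (Xθ + X) * t ^ α =
        c * (Real.exp ((1 + δ) * (r + 3)) * Real.exp (-(δ * torusSupNorm (Mk (⟨d + 1, L, m, K, hd, hL⟩ : Params) j) (rep (Mk (⟨d + 1, L, m, K, hd, hL⟩ : Params) j) (iterBlockOf j b₁.src) - rep (Mk (⟨d + 1, L, m, K, hd, hL⟩ : Params) j) y'))) * (Xθ + X) * t ^ α) := fun c => by ring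
    rw [e, e]
    exact mul_le_mul_of_nonneg_right hCC hE0
  by_cases h0 : supDist b₁.src b₂.src = 0
  · -- `b₁ = b₂`: nothing to prove
    have hb : b₁ = b₂ := by
      have hs : b₁.src = b₂.src := (supDist_eq_zero_iff _ _).1 h0
      cases b₁; cases b₂
      simp only at hs hdir
      subst hs; subst hdir; rfl
    subst hb
    rw [sub_self, abs_zero]
    positivity
  have hpos : 0 < t := by rw [ht]; exact div_pos (by exact_mod_cast Nat.pos_of_ne_zero h0) hLj
  by_cases hsm : t ≤ 1 / 4
  · -- CLOSE PAIRS: `n ≥ 4`, so `j ≥ 1`, and §2 applies with §1 at the rate `δ ≤ δ_H`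
    have hj1 : 1 ≤ j := by
      by_contra hj0
      have hj0' : j = 0 := by omega
      have h1t : (1 : ℝ) ≤ t := by
        rw [ht, hj0', pow_zero, div_one]
        exact_mod_cast Nat.pos_of_ne_zero h0
      linarith
    -- the member at the rate `δ_H` and constant `O(1)(α,ε)` implies the member at `(max(O(1),0), δ)`
    have H' : ∀ (T : LocR (((⟨d + 1, L, m, K, hd, hL⟩ : Params).L) ^ j) (Mk (⟨d + 1, L, m, K, hd, hL⟩ : Params) j)) (ζ : Tor (fine (((⟨d + 1, L, m, K, hd, hL⟩ : Params).L) ^ j) (Mk (⟨d + 1, L, m, K, hd, hL⟩ : Params) j)) → ℝ) (y y' : Tor (Mk (⟨d + 1, L, m, K, hd, hL⟩ : Params) j)),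
        cutInL (((⟨d + 1, L, m, K, hd, hL⟩ : Params).L) ^ j) (Mk (⟨d + 1, L, m, K, hd, hL⟩ : Params) j) ζ y → suppInL (((⟨d + 1, L, m, K, hd, hL⟩ : Params).L) ^ j) (Mk (⟨d + 1, L, m, K, hd, hL⟩ : Params) j) T.emb y' →
        h2L (((⟨d + 1, L, m, K, hd, hL⟩ : Params).L) ^ j) (Mk (⟨d + 1, L, m, K, hd, hL⟩ : Params) j) a T.emb α ζ ≤
          max (Cαε α ε) 0 * Real.exp (-(δ * distSite (Mk (⟨d + 1, L, m, K, hd, hL⟩ : Params) j) y y')) * cutHL (((⟨d + 1, L, m, K, hd, hL⟩ : Params).L) ^ j) (Mk (⟨d + 1, L, m, K, hd, hL⟩ : Params) j) α ζ *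
            (holderL (((⟨d + 1, L, m, K, hd, hL⟩ : Params).L) ^ j) (Mk (⟨d + 1, L, m, K, hd, hL⟩ : Params) j) (α + ε) T.emb + supNormL (((⟨d + 1, L, m, K, hd, hL⟩ : Params).L) ^ j) (Mk (⟨d + 1, L, m, K, hd, hL⟩ : Params) j) T.emb) := by
      intro T ζ y y'' hζ hT
      refine (HH (⟨d + 1, L, m, K, hd, hL⟩ : Params) rfl rfl j hj1 hj' α ε T ζ y y'' hα0 hε0 hαε hζ hT).trans ?_
      have hDn : 0 ≤ distSite (Mk (⟨d + 1, L, m, K, hd, hL⟩ : Params) j) y y'' := B5Prop12FieldsLattice.distSite_nonneg _ _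
      have hN : 0 ≤ holderL (((⟨d + 1, L, m, K, hd, hL⟩ : Params).L) ^ j) (Mk (⟨d + 1, L, m, K, hd, hL⟩ : Params) j) (α + ε) T.emb + supNormL (((⟨d + 1, L, m, K, hd, hL⟩ : Params).L) ^ j) (Mk (⟨d + 1, L, m, K, hd, hL⟩ : Params) j) T.emb :=
        add_nonneg (B5Prop12FieldsLattice.holderL_nonneg _ _) (B5Prop12FieldsLattice.supNormL_nonneg _)
      have hζn : 0 ≤ cutHL (((⟨d + 1, L, m, K, hd, hL⟩ : Params).L) ^ j) (Mk (⟨d + 1, L, m, K, hd, hL⟩ : Params) j) α ζ := B5Prop12FieldsLattice.cutHL_nonneg α ζ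
      have e1 : Real.exp (-(δH * distSite (Mk (⟨d + 1, L, m, K, hd, hL⟩ : Params) j) y y'')) ≤ Real.exp (-(δ * distSite (Mk (⟨d + 1, L, m, K, hd, hL⟩ : Params) j) y y'')) :=
        Real.exp_le_exp.mpr (by nlinarith)
      have e2 : Cαε α ε * Real.exp (-(δH * distSite (Mk (⟨d + 1, L, m, K, hd, hL⟩ : Params) j) y y'')) ≤ max (Cαε α ε) 0 * Real.exp (-(δ * distSite (Mk (⟨d + 1, L, m, K, hd, hL⟩ : Params) j) y y'')) :=
        (mul_le_mul_of_nonneg_right (le_max_left _ _) (Real.exp_pos _).le).trans (mul_le_mul_of_nonneg_left e1 hm)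
      exact mul_le_mul_of_nonneg_right (mul_le_mul_of_nonneg_right e2 hζn) hN
    have h := abs_DGEDadj_sub_le_close hj' hc ha hw' hm hδ.le hα0 (by linarith) hε0 hαε H' lam mu x hX hXθ y' hsupp hx hH b₁ b₂ hdir
      (by rw [hdU]; exact hpos) (by rw [hdU]; exact hsm)
    rw [hdU] at h
    refine h.trans ?_
    refine (le_of_eq ?_).trans (weak (Cb := max (Cαε α ε) 0 * latticeConst (d + 1) 1 * ((Lθ (d + 1) + 1) * (max 1 (Lw (d + 1)) + 1) * Real.exp (3 * δ))) ?_)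
    · ring
    · have : 0 ≤ 4 * CS * (1 + Real.exp δ) := by positivity
      linarith
  · -- FAR PAIRS (`¼ < t ≤ 1`): (1.112) with Hölder input (file M1b) at both bonds, `t^{−α} ≤ 4`
    have hs : torusSupNorm (Mk (⟨d + 1, L, m, K, hd, hL⟩ : Params) j) (rep (Mk (⟨d + 1, L, m, K, hd, hL⟩ : Params) j) (iterBlockOf j b₁.src) - rep (Mk (⟨d + 1, L, m, K, hd, hL⟩ : Params) j) y') ≤ torusSupNorm (Mk (⟨d + 1, L, m, K, hd, hL⟩ : Params) j) (rep (Mk (⟨d + 1, L, m, K, hd, hL⟩ : Params) j) (iterBlockOf j b₂.src) - rep (Mk (⟨d + 1, L, m, K, hd, hL⟩ : Params) j) y') + 1 := by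
      have h12 : torusSupNorm (Mk (⟨d + 1, L, m, K, hd, hL⟩ : Params) j) (rep (Mk (⟨d + 1, L, m, K, hd, hL⟩ : Params) j) (iterBlockOf j b₁.src) - rep (Mk (⟨d + 1, L, m, K, hd, hL⟩ : Params) j) (iterBlockOf j b₂.src)) ≤ 1 := by
        rw [← supDist_cast_eq_torusSupNorm]
        exact_mod_cast supDist_blk_le_one hj' b₁.src b₂.src hle
      have htri := hρ.triangle (iterBlockOf j b₁.src) (iterBlockOf j b₂.src) y'
      dsimp only at htri
      linarith
    have hb1 := hS m K j hj' hc hw' lam mu x X Xθ r hX hXθ y' hsupp hx hH b₁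
    have hb2 := hS m K j hj' hc hw' lam mu x X Xθ r hX hXθ y' hsupp hx hH b₂
    have htq : 1 / 4 < t := lt_of_not_ge hsm
    have h4 : (1 : ℝ) ≤ 4 * t ^ α := by
      have h1 : t ≤ t ^ α := self_le_rpow_of_le_one' ht0 ht1 (by linarith)
      linarith
    have key := far_pair_le (S₁ := |(((((L : ℝ) ^ j) • (onE (LinearMap.funLeft ℝ ℝ (fun b : PBond (⟨d + 1, L, m, K, hd, hL⟩ : Params) 0 => (⟨b.src.shift mu, b.dir⟩ : PBond (⟨d + 1, L, m, K, hd, hL⟩ : Params) 0))) - LinearMap.id) : BondSpace (⟨d + 1, L, m, K, hd, hL⟩ : Params) →ₗ[ℝ] BondSpace (⟨d + 1, L, m, K, hd, hL⟩ : Params))) ∘ₗ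
      (GE (Domains.whole (P := (⟨d + 1, L, m, K, hd, hL⟩ : Params)) j hj') hc (w := fun _ => a * ((L : ℝ) ^ j) ^ (d + 1)) (fun _ => hw') ∘ₗ ((((L : ℝ) ^ j) • (onE (LinearMap.funLeft ℝ ℝ (fun b : PBond (⟨d + 1, L, m, K, hd, hL⟩ : Params) 0 => (⟨b.src.unshift lam, b.dir⟩ : PBond (⟨d + 1, L, m, K, hd, hL⟩ : Params) 0))) - LinearMap.id) : BondSpace (⟨d + 1, L, m, K, hd, hL⟩ : Params) →ₗ[ℝ] BondSpace (⟨d + 1, L, m, K, hd, hL⟩ : Params))))) x b₁|) (S₂ := |(((((L : ℝ) ^ j) • (onE (LinearMap.funLeft ℝ ℝ (fun b : PBond (⟨d + 1, L, m, K, hd, hL⟩ : Params) 0 => (⟨b.src.shift mu, b.dir⟩ : PBond (⟨d + 1, L, m, K, hd, hL⟩ : Params) 0))) - LinearMap.id) : BondSpace (⟨d + 1, L, m, K, hd, hL⟩ : Params) →ₗ[ℝ] BondSpace (⟨d + 1, L, m, K, hd, hL⟩ : Params))) ∘ₗ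
      (GE (Domains.whole (P := (⟨d + 1, L, m, K, hd, hL⟩ : Params)) j hj') hc (w := fun _ => a * ((L : ℝ) ^ j) ^ (d + 1)) (fun _ => hw') ∘ₗ ((((L : ℝ) ^ j) • (onE (LinearMap.funLeft ℝ ℝ (fun b : PBond (⟨d + 1, L, m, K, hd, hL⟩ : Params) 0 => (⟨b.src.unshift lam, b.dir⟩ : PBond (⟨d + 1, L, m, K, hd, hL⟩ : Params) 0))) - LinearMap.id) : BondSpace (⟨d + 1, L, m, K, hd, hL⟩ : Params) →ₗ[ℝ] BondSpace (⟨d + 1, L, m, K, hd, hL⟩ : Params))))) x b₂|)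
      (C := CS * Real.exp ((1 + δ) * (r + 3)) * (Xθ + X)) (by positivity) hδ.le
      (by refine hb1.trans (le_of_eq ?_); ring) (by refine hb2.trans (le_of_eq ?_); ring) hs h4
    refine (abs_sub _ _).trans (key.trans ?_)
    refine (le_of_eq ?_).trans (weak (Cb := 4 * CS * (1 + Real.exp δ)) ?_)
    · ring
    · have : 0 ≤ max (Cαε α ε) 0 * latticeConst (d + 1) 1 * ((Lθ (d + 1) + 1) * (max 1 (Lw (d + 1)) + 1) * Real.exp (3 * δ)) := by positivity
      linarith

end Literature.MathematicalPhysics.QuantumFieldTheory.Balaban1983to89.B6Block113GEV1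

end
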